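import Mathlib
import Literature.Analysis.ODE.LinearGrowth

/-!
# The scalar complex Riccati equation with real continuous coefficients: global solutions with
# positive imaginary part, via the Jacobi system

Topic `Literature/Analysis/ODE` (namespace `Literature.Analysis.ODE`). Everything is proved; no
definitions.

In the construction of a Gaussian beam `a e^{iλφ}` (J. Ralston, *Gaussian beams and the
propagation of singularities*, MAA Stud. Math. 23 (1982), §2; J. Sbierski, Anal. PDE 8 (2015),
§3 = arXiv:1311.2477 §2.2, (2.19)–(2.27)) the Hessian of the phase along the bicharacteristic
solves a Riccati equation, GLOBALLY in the parameter, with positive-definite imaginary part; the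
mechanism is the linear Jacobi system and the conservation of the symplectic form. For ONE
transversal dimension (beams for `u_tt − u_xx + V(x)u = 0` on the line) everything is scalar:
for real continuous coefficients `A, B, C : ℝ → ℝ` the **Jacobi system**

  `J' = B J + C W`,  `W' = −A J − B W`

has global complex solutions (`exists_scalarJacobi`, a linear system of linear growth on every
bounded interval — `Literature.Analysis.ODE.exists_solution_of_linearGrowth`), along which
`Im (conj J · W)` is CONSTANT (`scalarJacobi_im_conj_mul_const`; the derivative of `conj J · W` is
the real number `C|W|² − A|J|²`). Hence for data `(J, W)(0) = (1, Γ₀)` with `Im Γ₀ > 0` the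
function `J` never vanishes, and `Γ := W/J` is a global `C¹` solution of the **Riccati equation**

  `Γ' = −A − 2B Γ − C Γ²`,  `Γ(0) = Γ₀`,  `Im Γ(t) = Im Γ₀ / |J(t)|² > 0`

(`exists_complexRiccati_im_pos`). If moreover `A, B, C ∈ C¹` then `Γ ∈ C²`
(`exists_complexRiccati_im_pos_C2`) — the regularity consumed by the first-order beam, whose
residual contains `Γ''`.

## References

* J. Ralston, *Gaussian beams and the propagation of singularities*, in: Studies in Partial
  Differential Equations, MAA Stud. Math. 23 (1982) 206–248, §2 (the Riccati equation and the
  lemma on `Im M > 0`). Key `Ralston1982`.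
* J. Sbierski, Anal. PDE 8 (2015) 1379–1420, §3 (arXiv:1311.2477v2 §2.2, pp. 12–14). Key
  `Sbierski2015`.
-/

noncomputable section

namespace Literature.Analysis.ODE

open Set Filter Topology Complex
open scoped NNReal ComplexConjugate

variable {A B C : ℝ → ℝ}

/-! ### The Jacobi system -/

/-- **Global solutions of the scalar Jacobi system.** For real continuous `A, B, C` and any
complex data there are `J, W : ℝ → ℂ` with `J 0 = J₀`, `W 0 = W₀`, `J' = BJ + CW`,
`W' = −AJ − BW` on all of `ℝ`. [cite: Sbierski2015, §3 (arXiv §2.2, (2.24)); folklore (linear ODE)] -/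
theorem exists_scalarJacobi (hA : Continuous A) (hB : Continuous B) (hC : Continuous C)
    (J₀ W₀ : ℂ) :
    ∃ J W : ℝ → ℂ, J 0 = J₀ ∧ W 0 = W₀ ∧
      (∀ t, HasDerivAt J ((B t : ℂ) * J t + (C t : ℂ) * W t) t) ∧
      (∀ t, HasDerivAt W (-(A t : ℂ) * J t - (B t : ℂ) * W t) t) := by
  -- the linear field on `ℂ × ℂ`
  set v : ℝ → ℂ × ℂ → ℂ × ℂ := fun t p =>
    ((B t : ℂ) * p.1 + (C t : ℂ) * p.2, -(A t : ℂ) * p.1 - (B t : ℂ) * p.2) with hv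
  have hlin : ∀ t (p q : ℂ × ℂ), v t p - v t q = v t (p - q) := by
    intro t p q
    simp only [hv, Prod.fst_sub, Prod.snd_sub, Prod.mk_sub_mk, Prod.mk.injEq]
    constructor <;> ring
  -- coefficient bound on `[-T, T]`
  have hK : ∀ T : ℝ, ∃ K : ℝ≥0, ∀ t ∈ Icc (-T) T, LipschitzWith K (v t) ∧ ∀ x, ‖v t x‖ ≤ K * ‖x‖ := by
    intro T
    have hcont : Continuous fun t => |A t| + 2 * |B t| + |C t| := by fun_prop
    obtain ⟨K₀, hK₀⟩ := isCompact_Icc.exists_bound_of_continuousOn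
      (hcont.continuousOn (s := Icc (-T) T))
    have hK0 : 0 ≤ max K₀ 0 := le_max_right _ _
    refine ⟨⟨max K₀ 0, hK0⟩, fun t ht => ?_⟩
    have hb : |A t| + 2 * |B t| + |C t| ≤ max K₀ 0 := by
      have h := hK₀ t ht
      rw [Real.norm_eq_abs, abs_of_nonneg (by positivity)] at h
      exact h.trans (le_max_left _ _)
    have hgrowth : ∀ x : ℂ × ℂ, ‖v t x‖ ≤ max K₀ 0 * ‖x‖ := by
      intro x
      have h1 : ‖x.1‖ ≤ ‖x‖ := norm_fst_le x
      have h2 : ‖x.2‖ ≤ ‖x‖ := norm_snd_le x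
      have hx0 : 0 ≤ ‖x‖ := norm_nonneg _
      have e1 : ‖(B t : ℂ) * x.1 + (C t : ℂ) * x.2‖ ≤ (|B t| + |C t|) * ‖x‖ := by
        calc ‖(B t : ℂ) * x.1 + (C t : ℂ) * x.2‖
            ≤ ‖(B t : ℂ) * x.1‖ + ‖(C t : ℂ) * x.2‖ := norm_add_le _ _
          _ = |B t| * ‖x.1‖ + |C t| * ‖x.2‖ := by
              rw [norm_mul, norm_mul, Complex.norm_real, Complex.norm_real, Real.norm_eq_abs,
                Real.norm_eq_abs]
          _ ≤ |B t| * ‖x‖ + |C t| * ‖x‖ := by gcongr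
          _ = (|B t| + |C t|) * ‖x‖ := by ring
      have e2 : ‖-(A t : ℂ) * x.1 - (B t : ℂ) * x.2‖ ≤ (|A t| + |B t|) * ‖x‖ := by
        calc ‖-(A t : ℂ) * x.1 - (B t : ℂ) * x.2‖
            ≤ ‖-(A t : ℂ) * x.1‖ + ‖(B t : ℂ) * x.2‖ := norm_sub_le _ _
          _ = |A t| * ‖x.1‖ + |B t| * ‖x.2‖ := by
              rw [norm_mul, norm_mul, norm_neg, Complex.norm_real, Complex.norm_real,
                Real.norm_eq_abs, Real.norm_eq_abs]
          _ ≤ |A t| * ‖x‖ + |B t| * ‖x‖ := by gcongr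
          _ = (|A t| + |B t|) * ‖x‖ := by ring
      have hmax : ‖v t x‖ = max ‖(B t : ℂ) * x.1 + (C t : ℂ) * x.2‖
          ‖-(A t : ℂ) * x.1 - (B t : ℂ) * x.2‖ := rfl
      rw [hmax, max_le_iff]
      constructor
      · exact e1.trans (mul_le_mul_of_nonneg_right
          (by linarith [abs_nonneg (A t), abs_nonneg (B t)]) hx0)
      · exact e2.trans (mul_le_mul_of_nonneg_right
          (by linarith [abs_nonneg (C t), abs_nonneg (B t)]) hx0)
    refine ⟨LipschitzWith.of_dist_le_mul fun x y => ?_, fun x => hgrowth x⟩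
    rw [dist_eq_norm, dist_eq_norm, hlin]
    exact hgrowth (x - y)
  have hcont : ∀ x : ℂ × ℂ, Continuous (v · x) := by
    intro x
    simp only [hv]
    fun_prop
  obtain ⟨α, hα0, hα⟩ := exists_solution_of_linearGrowth hK hcont (J₀, W₀)
  refine ⟨fun t => (α t).1, fun t => (α t).2, by simp [hα0], by simp [hα0], fun t => ?_,
    fun t => ?_⟩
  · exact (hα t).fst
  · exact (hα t).snd

/-- **Conservation of the symplectic pairing.** Along the scalar Jacobi system with REAL
coefficients, `t ↦ Im (conj (J t) * W t)` is constant: its derivative is the imaginary part of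
the real number `C|W|² − A|J|²`. [cite: Sbierski2015, §3 (arXiv §2.2, (2.19) and (2.26))] -/
theorem scalarJacobi_im_conj_mul_const {J W : ℝ → ℂ}
    (hJ : ∀ t, HasDerivAt J ((B t : ℂ) * J t + (C t : ℂ) * W t) t)
    (hW : ∀ t, HasDerivAt W (-(A t : ℂ) * J t - (B t : ℂ) * W t) t) (t : ℝ) :
    (conj (J t) * W t).im = (conj (J 0) * W 0).im := by
  -- the pairing `P = conj J · W` has a REAL derivative, so `Im P` has derivative `0`
  have hP : ∀ s, HasDerivAt (fun s => (conj (J s) * W s).im) 0 s := by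
    intro s
    have hcJ : HasDerivAt (fun s => conj (J s)) (conj ((B s : ℂ) * J s + (C s : ℂ) * W s)) s := by
      simpa only [starRingEnd_apply] using (hJ s).star
    have hprod := hcJ.mul (hW s)
    rw [show (fun s => (conj (J s) * W s).im) = Complex.imCLM ∘ (fun s => conj (J s) * W s)
      from rfl]
    refine (Complex.imCLM.hasFDerivAt.comp_hasDerivAt s hprod).congr_deriv ?_
    simp only [Complex.imCLM_apply,
      Complex.mul_im, Complex.add_re, Complex.add_im, Complex.sub_re, Complex.sub_im,
      Complex.mul_re, Complex.conj_re, Complex.conj_im, Complex.ofReal_re, Complex.ofReal_im,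
      Complex.neg_re, Complex.neg_im, map_add, map_mul, Complex.conj_ofReal]
    ring
  exact is_const_of_deriv_eq_zero (f := fun s => (conj (J s) * W s).im)
    (fun s => (hP s).differentiableAt) (fun s => (hP s).deriv) t 0

/-! ### The Riccati equation -/

/-- **Global solution of the scalar complex Riccati equation with positive imaginary part.**
For real continuous `A, B, C` and `Γ₀` with `Im Γ₀ > 0` there is a global `Γ : ℝ → ℂ` with
`Γ 0 = Γ₀`, `Γ' = −A − 2BΓ − CΓ²` and `Im Γ(t) > 0` for all `t`; in fact `Γ = W/J` for the Jacobi
solution with data `(1, Γ₀)`, `J ≠ 0`, `Im Γ = Im Γ₀/|J|²`. [cite: Ralston1982, §2; Sbierski2015, §3 (arXiv §2.2, pp. 12–14)] -/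
theorem exists_complexRiccati_im_pos (hA : Continuous A) (hB : Continuous B) (hC : Continuous C)
    {Γ₀ : ℂ} (hΓ₀ : 0 < Γ₀.im) :
    ∃ Γ : ℝ → ℂ, Γ 0 = Γ₀ ∧
      (∀ t, HasDerivAt Γ (-(A t : ℂ) - 2 * (B t : ℂ) * Γ t - (C t : ℂ) * Γ t ^ 2) t) ∧
      (∀ t, 0 < (Γ t).im) ∧
      ∃ J W : ℝ → ℂ, J 0 = 1 ∧ W 0 = Γ₀ ∧ (∀ t, J t ≠ 0) ∧ (∀ t, Γ t = W t / J t) ∧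
        (∀ t, HasDerivAt J ((B t : ℂ) * J t + (C t : ℂ) * W t) t) ∧
        (∀ t, HasDerivAt W (-(A t : ℂ) * J t - (B t : ℂ) * W t) t) ∧
        (∀ t, (Γ t).im = Γ₀.im / Complex.normSq (J t)) := by
  obtain ⟨J, W, hJ0, hW0, hJ, hW⟩ := exists_scalarJacobi hA hB hC 1 Γ₀
  have hpair : ∀ t, (conj (J t) * W t).im = Γ₀.im := fun t => by
    rw [scalarJacobi_im_conj_mul_const hJ hW t, hJ0, hW0, map_one, one_mul]
  have hJne : ∀ t, J t ≠ 0 := fun t h => by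
    have := hpair t
    rw [h, map_zero, zero_mul, Complex.zero_im] at this
    exact hΓ₀.ne this
  have him : ∀ t, (W t / J t).im = Γ₀.im / Complex.normSq (J t) := fun t => by
    rw [div_eq_mul_inv, Complex.inv_def, ← mul_assoc, mul_comm (W t), Complex.mul_im,
      Complex.ofReal_re, Complex.ofReal_im, mul_zero, zero_add, ← hpair t, div_eq_mul_inv]
  refine ⟨fun t => W t / J t, by simp only [hJ0, hW0, div_one], fun t => ?_, fun t => ?_,
    J, W, hJ0, hW0, hJne, fun t => rfl, hJ, hW, him⟩
  · have h := (hW t).div (hJ t) (hJne t)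
    refine h.congr_deriv ?_
    field_simp [hJne t]
    ring
  · rw [him t]
    exact div_pos hΓ₀ (Complex.normSq_pos.2 (hJne t))

/-- Regularity of the Jacobi solutions: `C¹`; `C²` when the coefficients are `C¹`. [folklore] -/
theorem scalarJacobi_contDiff {J W : ℝ → ℂ} (hA : Continuous A) (hB : Continuous B)
    (hC : Continuous C)
    (hJ : ∀ t, HasDerivAt J ((B t : ℂ) * J t + (C t : ℂ) * W t) t)
    (hW : ∀ t, HasDerivAt W (-(A t : ℂ) * J t - (B t : ℂ) * W t) t) :
    ContDiff ℝ 1 J ∧ ContDiff ℝ 1 W ∧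
      (ContDiff ℝ 1 A → ContDiff ℝ 1 B → ContDiff ℝ 1 C → ContDiff ℝ 2 J ∧ ContDiff ℝ 2 W) := by
  have hJc : Continuous J := continuous_iff_continuousAt.2 fun t => (hJ t).continuousAt
  have hWc : Continuous W := continuous_iff_continuousAt.2 fun t => (hW t).continuousAt
  have hdJ : deriv J = fun t => (B t : ℂ) * J t + (C t : ℂ) * W t := funext fun t => (hJ t).deriv
  have hdW : deriv W = fun t => -(A t : ℂ) * J t - (B t : ℂ) * W t := funext fun t => (hW t).deriv
  have hJ1 : ContDiff ℝ 1 J := by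
    rw [contDiff_one_iff_deriv]
    exact ⟨fun t => (hJ t).differentiableAt, by rw [hdJ]; fun_prop⟩
  have hW1 : ContDiff ℝ 1 W := by
    rw [contDiff_one_iff_deriv]
    exact ⟨fun t => (hW t).differentiableAt, by rw [hdW]; fun_prop⟩
  refine ⟨hJ1, hW1, fun hA1 hB1 hC1 => ?_⟩
  have hA1' : ContDiff ℝ 1 fun t => (A t : ℂ) := Complex.ofRealCLM.contDiff.comp hA1
  have hB1' : ContDiff ℝ 1 fun t => (B t : ℂ) := Complex.ofRealCLM.contDiff.comp hB1
  have hC1' : ContDiff ℝ 1 fun t => (C t : ℂ) := Complex.ofRealCLM.contDiff.comp hC1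
  constructor
  · rw [show (2 : WithTop ℕ∞) = 1 + 1 from rfl, contDiff_succ_iff_deriv, hdJ]
    exact ⟨fun t => (hJ t).differentiableAt, by simp, (hB1'.mul hJ1).add (hC1'.mul hW1)⟩
  · rw [show (2 : WithTop ℕ∞) = 1 + 1 from rfl, contDiff_succ_iff_deriv, hdW]
    exact ⟨fun t => (hW t).differentiableAt, by simp, (hA1'.neg.mul hJ1).sub (hB1'.mul hW1)⟩

/-- **`C²` Riccati solution for `C¹` coefficients.** For real `C¹` coefficients `A, B, C` and
`Im Γ₀ > 0` there is a global `C²` function `Γ : ℝ → ℂ` with `Γ 0 = Γ₀`, `Γ' = −A − 2BΓ − CΓ²`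
and `Im Γ > 0` everywhere. [cite: Ralston1982, §2; Sbierski2015, §3] -/
theorem exists_complexRiccati_im_pos_C2 (hA : ContDiff ℝ 1 A) (hB : ContDiff ℝ 1 B)
    (hC : ContDiff ℝ 1 C) {Γ₀ : ℂ} (hΓ₀ : 0 < Γ₀.im) :
    ∃ Γ : ℝ → ℂ, Γ 0 = Γ₀ ∧ ContDiff ℝ 2 Γ ∧
      (∀ t, HasDerivAt Γ (-(A t : ℂ) - 2 * (B t : ℂ) * Γ t - (C t : ℂ) * Γ t ^ 2) t) ∧
      (∀ t, 0 < (Γ t).im) := by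
  obtain ⟨Γ, hΓ0, hΓ', hΓim, J, W, hJ0, hW0, hJne, hΓJW, hJ, hW, -⟩ :=
    exists_complexRiccati_im_pos hA.continuous hB.continuous hC.continuous hΓ₀
  obtain ⟨-, -, h2⟩ := scalarJacobi_contDiff hA.continuous hB.continuous hC.continuous hJ hW
  obtain ⟨hJ2, hW2⟩ := h2 hA hB hC
  refine ⟨Γ, hΓ0, ?_, hΓ', hΓim⟩
  have hΓeq : Γ = fun t => W t * (J t)⁻¹ := funext fun t => by rw [hΓJW, div_eq_mul_inv]
  rw [hΓeq]
  exact hW2.mul (hJ2.inv hJne)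

end Literature.Analysis.ODE
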